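import Summits.BirchSwinnertonDyer.Rank1Residual.ManinAdditive.JumpDegreeLaws
import HarnessLib
import HarnessLib.Audit.Tags

/-!
# Edixhoven's stable fibre of `X₀(p²M)` at `p ≥ 5`: the IGUSA / SUPERCUSPIDAL DIVISIBILITY LAWS for the modular degree,
# and the supercuspidal half of the starred-degree law — E-desc-112/113, 114, 115 typed (desc g16c, MEMO-desc §34B; T-desc-26; typer g17)

TYPER NOTE.  SOURCE = HOME/desc/g16c/Sketch-desc-g16c.lean sha16 6d47f547191ae713 (211 l.; farm rc 0 · 0 err · 0 warn · 0 sorry per desc,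
check-g16c.json), landed VERBATIM as the third `JumpDegree*` leaf except: (i) this note; (ii) namespace `…ManinAdditive.DescG16c` folded to
`…ManinAdditive.JumpDegree` (the namespace of `JumpDegreeLaws.lean` p691457, which this file imports); (iii) a docstring
on `two_le_of_hasTameExponentAt`; (iv) the `Edixhoven1990` page locators set to the PRINTED pages (55 / 59–60 / 62 / 64–66).  Three `@[conjecture]` rows (nothing
asserted): **E-desc-112/113 `PrincipalSeriesDivisibilityLaw p`**, **E-desc-114 `SupercuspidalDivisibilityLaw p`**, **E-desc-115
`StarredDegreeLawSupercuspidal p`** (THEOREM-CANDIDATE: THEOREM Q on paper); three E-blind predicates (`HasPrimeFactorTwoModThree`,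
`NoSupersingularEllipticPoint`, `HasTameExponentAt`); six PROVED lemmas incl. `starredDegreeLawSupercuspidal_of_all` (E-115 ⟸ E-110).
BC5: HOME/desc/g16c/out-igusa-div.txt 8bf078cdc668a344 — ALL Cremona curves `N < 5·10⁵`: 741 457 incidences, 0 exceptions (E-112/113/114);
E-115 106 829 / 0.  REFUTER VERDICTS: R-desc-26 (ref1) PENDING at filing — repairs under NEW names.  bears_on: stmt-BirchSwinnertonDyer-22967 (C2).

HONEST FRAMING.  LENS = descent / Néron models under (tame) additive base change (planner `bsd-f2-manin-desc`, g16,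
third instalment).  NOTHING is asserted: `@[conjecture] def … : Prop` rows + kernel-checked elementary lemmas.  Namespace
`…ManinAdditive.JumpDegree` (this landed copy sits next to `JumpDegreeLaws.lean`, whose preamble the rows copy
VERBATIM: globally minimal `W`, a modular parametrisation datum `D` AT THE CONDUCTOR LEVEL — so every row is about ALL
parametrisations `X₀(N) → E`, optimal or not).

THE MECHANISM (MEMO-desc §34B, THEOREM Q; paper-level, inputs labelled there).  `p ≥ 5`, `p ∤ M`, `N = p²M`,
`W₁ = W(𝔽̄_p)[t]/(t^e′ − p)`, `e′ = (p² − 1)/2`, `σ ∈ μ_e′` the tame inertia.  Edixhoven (Ann. Inst. Fourier 40 (1990)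
Thm. 2.1.2, §2.2.4, Thm. 2.3.2.2) gives the STABLE model of `X₀(p²M)` over `W₁`; its special fibre consists of
(o) two copies of `X₀(M)_𝔽̄_p` (σ trivial), (i) two IGUSA components `Ig(p)/{±1}` over `X₀(M)_𝔽̄_p` (Galois group
`𝔽_p^×/{±1}`, cyclic of order `(p−1)/2`), SWAPPED by `σ`, with `σ²` = a generator of the diamond operators, (h) over each
supersingular point `x` of `X₀(M)_𝔽̄_p` one HORIZONTAL curve `C_x : y^(p+1) = x(x−1)^(p−1)` (genus `(p−1)/2`; replaced by
its quotient `Y^((p+1)/2) = …` resp. `Y^((p+1)/3) = …` when `x` is an elliptic point of order 2 resp. 3 of `X₀(M)`), on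
which `σ` acts through `μ_(p+1)`, `y ↦ ζy` (from the blow-up coordinate `x = uz`, `z^(p+1) = p`), and (t) a torus of rank
`3(s − 1)`.  CHECKS: `g(X₀(p²M)) = 2g₀ + 2g_Ig + Σ_x g(C_x) + 3(s−1)` (e.g. `X₀(150)`: 0 + 2 + 8 + 9 = 19; `X₀(121)`:
0 + 0 + (2 + 1) + 3 = 6); `H⁰(C_x, Ω¹) = ⊕_{c=1}^{(p−1)/2} ζ^c` (basis `x^a (x−1)^b dx / y^i`, `(p+3)/2 ≤ i ≤ p`);
the cotangent character of a potentially good `E` with `e_E ∣ p+1` is `ζ^((p+1)·jump(E))`, `jump = v_p(Δ_min)/12`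
(orientation anchored on `X₀(49) = 49a1`, III, `deg φ = 1`, and on `X₀(121)`: 121a1/121c1 (II, IV) sit on the
`j = 1728` component with characters `ζ², ζ⁴`, 121b1 (III) on the `j = 0` component with character `ζ³`, degrees 6, 6, 4
all prime to 11).  CONSEQUENCES.  A parametrisation `φ : X₀(N) → E` of conductor `N` extends to the minimal
desingularisation of the stable model (Weil; `E` has good reduction over `W₁` iff `e_E ∣ e′`, always true), the special
fibre is reduced, so `deg φ = Σ_Y deg(φ̄ |_Y)`; `φ̄` is `σ`-EQUIVARIANT (`φ̄ ∘ σ = α_E(σ) ∘ φ̄`, `α_E` of exact order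
`e_E = 12/gcd(12, v_p Δ_min)`), hence (a) CONSTANT on every component on which `σ` acts through a group not surjecting onto
`μ_(e_E)` (outer components always; Igusa components when `e_E ∤ p − 1`; horizontal components when `e_E ∤ p + 1`, or at an
elliptic point whose quotient kills the surjection), and (b) on the other components it FACTORS through the quotient by
`D₀ = ker(σ-group → ⟨α_E⟩)`:  through `Ig(p)/{±1} → I_m` (`m = ord α_E²`, a cover of `X₀(M)` of degree `(p−1)/(2m)`) on
each of the two Igusa components when `e_E ∣ p − 1` (PRINCIPAL SERIES), and through `C_x → C_x/⟨ζ^(e_E)⟩` (degree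
`(p+1)/e_E`, resp. `(p+1)/(2e_E)`, `(p+1)/(3e_E)` at elliptic points) when `e_E ∤ p − 1` (SUPERCUSPIDAL, `e_E ∣ p + 1`).
This gives the E-blind DIVISIBILITY LAWS below (rows E-desc-112/113/114; census HOME/desc/g16c/out-igusa-div.txt: all
Cremona curves `N < 5·10⁵`, optimal and non-optimal, 741 457 (curve, prime) incidences, 0 exceptions), and (c) — characters —
on a horizontal component only the characters `ζ^c`, `1 ≤ c ≤ (p−1)/2`, i.e. the JUMPS `c/(p+1) < 1/2`, occur, so a STARRED
supercuspidal `E` (jump `2/3, 3/4, 5/6`, character exponent `(p+1)·jump > (p+1)/2`) receives only INSEPARABLE component maps: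
`p ∣ deg φ` — row E-desc-115, the supercuspidal half of E-desc-110 / E-imc-10, now a THEOREM-CANDIDATE (106 829 optimal +
non-optimal incidences, 0 exceptions).  On the Igusa components the `σ`-characters come in PAIRS `{j, j + 1/2}` (induction
from `⟨σ²⟩` to `⟨σ⟩` of the diamond characters), so the jumps `2/3, 3/4, 5/6` DO occur in the principal-series part of
`J₀(p²M)` (e.g. `J₀(150)` at 5: jumps `{1/4, 3/4}` = 150a1 (III), 150b1 (III*)): conjecture J♮ of MEMO-desc §34 is TRUE on
the supercuspidal part and FALSE on the principal-series part, where `p ∣ deg φ` for starred curves is instead the cell's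
ramified-twist degree law (E-imc-6 / E-imc-3b: `deg(X₀(N) → E ⊗ χ_(p*)) = p · deg(X₀(N) → E)`, re-verified here:
193 828 / 193 830 twist pairs at `p ≥ 5` and 58 131 / 58 131 at `p = 3`, HOME/desc/g16c/out-twist-law2.txt, -law3.txt).

IN PRINT / NOT (MEMO-desc §34B.7, source-labelled): the stable model — [corpus: paper:doi-10-5802-aif-1202, Thm 2.1.2
p. 55, §2.2.4 pp. 59–60, Thm 2.3.2.2 p. 62, §2.5 pp. 64–66 — printed page numbers, verified by the typer on the materialised text]; the inertia action on it is deferred there to Edixhoven's thesis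
(acq-14418, not held); modular-degree divisibility by `(p ± 1)/e` at an additive prime: no hits (corpus fts + hybrid + vec,
galaxy; queries in §34B.7).  bears_on: stmt-BirchSwinnertonDyer-22968 (C3) only through the `p = 3` shadow (§34B.6:
the same fibre shape at `p = 3`, `e′ = 4` tame, would prove E-desc-109 and HYPOTHESIS P₃ of §34A).
PARTITION 0 · beyond-print theorem: yes on paper (THEOREM Q ⇒ E-desc-112/113/114/115), no in Lean (statements only) ·
BSD is not proved by this; Manin's conjecture is not proved by this.
-/

set_option autoImplicit false

noncomputable section

open scoped MatrixGroups ModularForm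

open CongruenceSubgroup WeierstrassCurve Literature.NumberTheory.EllipticCurves.ModularForms
  Literature.NumberTheory.DiophantineGeometry
open Summit.BirchSwinnertonDyer.Rank1Residual.ManinAdditive.ConwayCut
open Summit.BirchSwinnertonDyer.Rank1Residual.ManinAdditive.JumpDegree

namespace Summit.BirchSwinnertonDyer.Rank1Residual.ManinAdditive.JumpDegree

/-! ### §1. E-blind predicates -/

/-- Some prime `q ≡ 2 (mod 3)` divides `M` (then `X₀(M)` has no elliptic point of order 3: `ε₃(M) = 0`; `q = 2` counts). -/
def HasPrimeFactorTwoModThree (M : ℕ) : Prop :=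
  ∃ q : ℕ, q.Prime ∧ q ∣ M ∧ q % 3 = 2

/-- `X₀(M)` has NO elliptic point of order 2 lying over a supersingular `j = 1728` in characteristic `p`, E-blindly:
either `1728` is ordinary (`p ≡ 1 (mod 4)`) or `ε₂(M) = 0` (`4 ∣ M` or a prime `≡ 3 (mod 4)` divides `M`); and the same for
order 3 / `j = 0` (`p ≡ 1 (mod 3)`, or `9 ∣ M`, or a prime `≡ 2 (mod 3)` divides `M`).  Under this condition every
horizontal component of Edixhoven's stable fibre of `X₀(p²M)` is the generic curve `y^(p+1) = x(x−1)^(p−1)`. -/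
def NoSupersingularEllipticPoint (p M : ℕ) : Prop :=
  (p % 4 = 1 ∨ 4 ∣ M ∨ HasPrimeFactorThreeModFour M) ∧ (p % 3 = 1 ∨ 9 ∣ M ∨ HasPrimeFactorTwoModThree M)

/-- The tame local exponent at `p ≥ 5`: `E` (globally minimal model `W`) has potentially good reduction at `p` with
semistability defect `e ∈ {2, 3, 4, 6}`, read off `v_p(Δ_min)` (`e = 12 / gcd(12, v_p Δ_min)`): `e = 2` ↔ I₀* (`v = 6`),
`e = 3` ↔ IV, IV* (`v = 4, 8`), `e = 4` ↔ III, III* (`v = 3, 9`), `e = 6` ↔ II, II* (`v = 2, 10`). -/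
def HasTameExponentAt (W : WeierstrassCurve ℚ) [W.IsElliptic] (p e : ℕ) : Prop :=
  0 ≤ padicValRat p W.j ∧
    ((e = 2 ∧ padicValRat p W.Δ = 6) ∨
     (e = 3 ∧ (padicValRat p W.Δ = 4 ∨ padicValRat p W.Δ = 8)) ∨
     (e = 4 ∧ (padicValRat p W.Δ = 3 ∨ padicValRat p W.Δ = 9)) ∨
     (e = 6 ∧ (padicValRat p W.Δ = 2 ∨ padicValRat p W.Δ = 10)))

/-- A tame exponent is one of `2, 3, 4, 6` (bookkeeping; the `0 ≤ v_p(j)` clause is not used). -/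
theorem two_le_of_hasTameExponentAt {W : WeierstrassCurve ℚ} [W.IsElliptic] {p e : ℕ}
    (h : HasTameExponentAt W p e) :
    e = 2 ∨ e = 3 ∨ e = 4 ∨ e = 6 := by
  rcases h.2 with h2 | h3 | h4 | h6
  · exact Or.inl h2.1
  · exact Or.inr (Or.inl h3.1)
  · exact Or.inr (Or.inr (Or.inl h4.1))
  · exact Or.inr (Or.inr (Or.inr h6.1))

/-- `36 ∣ M` kills both kinds of elliptic points, whatever `p`. -/
theorem noSupersingularEllipticPoint_of_thirtysix_dvd (p M : ℕ) (h : 36 ∣ M) :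
    NoSupersingularEllipticPoint p M :=
  ⟨Or.inr (Or.inl (Nat.dvd_trans (by norm_num) h)), Or.inr (Or.inl (Nat.dvd_trans (by norm_num) h))⟩

/-- `M = 6` (the level of `X₀(150) = X₀(5²·6)`): `2 ≡ 2 (mod 3)` and `3 ≡ 3 (mod 4)` divide it. -/
theorem noSupersingularEllipticPoint_six (p : ℕ) : NoSupersingularEllipticPoint p 6 :=
  ⟨Or.inr (Or.inr ⟨3, Nat.prime_three, by norm_num, by norm_num⟩),
   Or.inr (Or.inr ⟨2, Nat.prime_two, by norm_num, by norm_num⟩)⟩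

/-! ### §2. The rows -/

/-- **Row E-desc-112/113 `PrincipalSeriesDivisibilityLaw p` (LAW with mechanism = THEOREM Q (b), Igusa side; desc g16c,
MEMO-desc §34B.3; nothing asserted).**  `p ≥ 5`, `p² ∥ N`, `E` potentially good at `p` with tame exponent `e ∣ p − 1`
(principal series: I₀* always; III/III* iff `p ≡ 1 (4)`; IV/IV*/II/II* iff `p ≡ 1 (3)`).  Then EVERY parametrisation
`X₀(N) → E` has degree divisible by `(p − 1)/m`, `m = ord(α_E²) = e / gcd(e, 2)` (`= 1, 2, 3, 3` for `e = 2, 4, 3, 6`):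
`φ̄` is constant off the two Igusa components and factors on each through `Ig(p)/{±1} → I_m`, of degree `(p−1)/(2m)`, with
equal degrees on the two (they are swapped by inertia).  Census (HOME/desc/g16c/out-igusa-div.txt, all curves `N < 5·10⁵`):
I₀* 113 977 optimal + 77 670 non-optimal, `e = 4` 72 320 + 29 420, `e ∈ {3, 6}` 2 × (48 948 + 6 325) incidences, 0
exceptions; for I₀* the modulus `p − 1` is the EXACT universal divisor at every `p ≤ 31` (out-universal-gcd.txt; e.g.
275b1 = 11a1 ⊗ χ₅: `deg φ = 28 = (5−1)·#Ē′(𝔽₅)`), for `e = 4` resp. `3, 6` the observed universal divisor is `2(p−1)`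
resp. `p − 1` (the extra factor `2m` resp. `m` is NOT explained by THEOREM Q — open O-34B.2).  Why it might fail: only via
the identification of the Igusa components as `Ig(p)/{±1}` (not `Ig(p)`) and of `σ²` with a generator of the diamond group
(Edixhoven 1990 Thm 2.1.2 as read by the cell; the inertia action is deferred there to the 1989 thesis, acq-14418).
[cite: Edixhoven1990, Thm. 2.1.2 (p. 55: the stable model of X₀(p²) × X₀(M)-structure over W[t]/(t^((p²−1)/2) − p), p ≥ 5; Thm. 2.3.2.2 p. 62: the two non-outer vertical components are Igusa curves Ig(p)/±1; the divisibility law is the cell's row E-desc-112/113 — MEMO-desc §34B, NOT in print)]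
[cite: Watkins2002, §2.1 (shape only: modular degrees of all Cremona curves, the census base)] -/
@[conjecture]
def PrincipalSeriesDivisibilityLaw (p : ℕ) : Prop :=
  ∀ (W : WeierstrassCurve ℚ) [W.IsElliptic] [W.IsGloballyMinimal] [NeZero (W.conductorNorm ℤ)]
    (D : ModularParametrizationData W (W.conductorNorm ℤ)) (e : ℕ),
    p.Prime → 5 ≤ p → padicValNat p (W.conductorNorm ℤ) = 2 → HasTameExponentAt W p e → e ∣ p - 1 →
      (p - 1) / (e / Nat.gcd e 2) ∣ D.modularDegree

/-- **Row E-desc-114 `SupercuspidalDivisibilityLaw p` (LAW with mechanism = THEOREM Q (b), horizontal side; desc g16c,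
MEMO-desc §34B.3; nothing asserted).**  `p ≥ 5`, `p² ∥ N`, `M = N/p²`, `E` potentially good at `p` with tame exponent
`e ∤ p − 1` (so `e ∈ {3, 4, 6}`, `e ∣ p + 1`: supercuspidal), and `X₀(M)` has no elliptic point over a supersingular
`j ∈ {0, 1728}` (`NoSupersingularEllipticPoint p M`, E-blind).  Then EVERY parametrisation `X₀(N) → E` has degree
divisible by `(p + 1)/e`: `φ̄` is constant on the four vertical components and factors on each horizontal curve
`C_x : y^(p+1) = x(x−1)^(p−1)` through `C_x → C_x/μ_((p+1)/e)`.  Census: 202 175 optimal + 38 517 non-optimal incidences,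
0 exceptions; the elliptic-point proviso is NECESSARY (49a1: `p = 7`, `e = 4`, `M = 1`, `deg φ = 1`; 121b1: `p = 11`,
`e = 4`, `deg φ = 4`), and with it weakened to `(p+1)/(e · gcd((p+1)/e, 2^[g₂] 3^[g₃]))` the remaining 13 376 + 1 512
incidences also pass (out-igusa-div.txt).  The modulus is the exact universal divisor for `e = 3` at `p = 5, 11, 29`.
Why it might fail: a level at which a horizontal component over a NON-elliptic supersingular point is nevertheless a proper
quotient of `y^(p+1) = x(x−1)^(p−1)` (excluded by Thm 2.1.2 as read; inertia action from the thesis, acq-14418).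
[cite: Edixhoven1990, Thm. 2.1.2 and §2.2.4 (pp. 55, 59–60: the horizontal components y^(p+1) = x(x−1)^(p−1) and their quotients at points with extra automorphisms; the law is the cell's row E-desc-114 — MEMO-desc §34B, NOT in print)]
[cite: Watkins2002, §2.1 (shape only)] -/
@[conjecture]
def SupercuspidalDivisibilityLaw (p : ℕ) : Prop :=
  ∀ (W : WeierstrassCurve ℚ) [W.IsElliptic] [W.IsGloballyMinimal] [NeZero (W.conductorNorm ℤ)]
    (D : ModularParametrizationData W (W.conductorNorm ℤ)) (e : ℕ),
    p.Prime → 5 ≤ p → padicValNat p (W.conductorNorm ℤ) = 2 → HasTameExponentAt W p e → ¬ e ∣ p - 1 →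
    NoSupersingularEllipticPoint p (W.conductorNorm ℤ / p ^ 2) →
      (p + 1) / e ∣ D.modularDegree

/-- **Row E-desc-115 `StarredDegreeLawSupercuspidal p` (THEOREM-CANDIDATE = THEOREM Q (c); desc g16c, MEMO-desc §34B.4;
nothing asserted).**  The supercuspidal half of E-desc-110 / E-imc-10: `p ≥ 5`, `p² ∥ N`, `E` potentially good and
STARRED at `p` (`v_p Δ_min ∈ {8, 9, 10}`) with `e ∤ p − 1`.  Then `p ∣ deg φ` for EVERY parametrisation at level `N`,
BECAUSE the cotangent character `ζ^((p+1)·jump)` of `Ē` (exponent `> (p+1)/2`) does not occur in `H⁰(C_x, Ω¹) =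
⊕_{1 ≤ c ≤ (p−1)/2} ζ^c` of any horizontal component, so every component map is inseparable (and `φ̄` is constant on the
vertical ones).  Census: 106 829 optimal starred supercuspidal incidences + the non-optimal ones, `N < 5·10⁵`, 0
exceptions (HOME/desc/g16b/out-p5-type-split-opt.txt; E-desc-110 total 191 937 + 41 996).  The principal-series half of
E-desc-110 is NOT covered by this mechanism (the Igusa characters pair `j ↔ j + 1/2`); there `p ∣ deg φ` is the ramified
twist law E-imc-6 (`deg` gains exactly one factor `p` under `E ↦ E ⊗ χ_(p*)`, 85 108 / 85 108 principal-series pairs).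
Why it might fail: the orientation of the inertia character (anchored on 49a1 and on the three curves of conductor 121 —
the opposite orientation contradicts `deg φ(49a1) = 1`).
[cite: Edixhoven1990, Thm. 2.1.2, §2.2.4 (pp. 55, 59–60: components and coordinates; the character computation and the law are the cell's THEOREM Q / row E-desc-115 — MEMO-desc §34B, NOT in print)]
[cite: Edixhoven1992NeronModelsTame, Thm. 5.3 (p. 300: jumps of the Néron filtration under tame base change = the dictionary character ↔ jump used here)] -/
@[conjecture]
def StarredDegreeLawSupercuspidal (p : ℕ) : Prop :=
  ∀ (W : WeierstrassCurve ℚ) [W.IsElliptic] [W.IsGloballyMinimal] [NeZero (W.conductorNorm ℤ)]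
    (D : ModularParametrizationData W (W.conductorNorm ℤ)) (e : ℕ),
    p.Prime → 5 ≤ p → padicValNat p (W.conductorNorm ℤ) = 2 → HasTameExponentAt W p e → ¬ e ∣ p - 1 →
    (padicValRat p W.Δ = 8 ∨ padicValRat p W.Δ = 9 ∨ padicValRat p W.Δ = 10) →
      p ∣ D.modularDegree

/-! ### §3. Edges (proved) -/

/-- E-desc-110 (all types) ⇒ E-desc-115 (its supercuspidal half). -/
theorem starredDegreeLawSupercuspidal_of_all {p : ℕ} (h : StarredDegreeLawAllParametrisations p) :
    StarredDegreeLawSupercuspidal p := by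
  intro W _ _ _ D e hp h5 hN he _ hv
  exact h W D hp h5 hN he.1 hv

/-- For I₀* (`e = 2`) the principal-series law reads `(p − 1) ∣ deg φ`. -/
theorem sub_one_dvd_of_principalSeriesDivisibilityLaw {p : ℕ} (h : PrincipalSeriesDivisibilityLaw p)
    (W : WeierstrassCurve ℚ) [W.IsElliptic] [W.IsGloballyMinimal] [NeZero (W.conductorNorm ℤ)]
    (D : ModularParametrizationData W (W.conductorNorm ℤ))
    (hp : p.Prime) (h5 : 5 ≤ p) (hN : padicValNat p (W.conductorNorm ℤ) = 2)
    (hj : 0 ≤ padicValRat p W.j) (hΔ : padicValRat p W.Δ = 6) :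
    (p - 1) ∣ D.modularDegree := by
  have h2 : HasTameExponentAt W p 2 := ⟨hj, Or.inl ⟨rfl, hΔ⟩⟩
  have hdvd : 2 ∣ p - 1 := by
    rcases hp.eq_two_or_odd with h | h
    · omega
    · omega
  simpa using h W D 2 hp h5 hN h2 hdvd

/-- For III / III* at `p ≡ 1 (mod 4)` the principal-series law reads `(p − 1)/2 ∣ deg φ`. -/
theorem half_sub_one_dvd_of_principalSeriesDivisibilityLaw {p : ℕ} (h : PrincipalSeriesDivisibilityLaw p)
    (W : WeierstrassCurve ℚ) [W.IsElliptic] [W.IsGloballyMinimal] [NeZero (W.conductorNorm ℤ)]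
    (D : ModularParametrizationData W (W.conductorNorm ℤ))
    (hp : p.Prime) (h5 : 5 ≤ p) (hN : padicValNat p (W.conductorNorm ℤ) = 2)
    (hj : 0 ≤ padicValRat p W.j) (hΔ : padicValRat p W.Δ = 3 ∨ padicValRat p W.Δ = 9) (h4 : p % 4 = 1) :
    (p - 1) / 2 ∣ D.modularDegree := by
  have h4' : HasTameExponentAt W p 4 := ⟨hj, Or.inr (Or.inr (Or.inl ⟨rfl, hΔ⟩))⟩
  have hdvd : 4 ∣ p - 1 := by omega
  simpa using h W D 4 hp h5 hN h4' hdvd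

end Summit.BirchSwinnertonDyer.Rank1Residual.ManinAdditive.JumpDegree
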